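import Mathlib
import Summits.QuantumFields.BalabanUV.Beta.EriceRemainderEnclosureHistoryAutonomyComparisonAgeCompositionStaticChainWindowBounds
import Summits.QuantumFields.BalabanUV.Beta.EriceRemainderEnclosureHistoryAutonomyComparisonAgeCompositionStaticChainAdjacentEnvelopes
import Summits.QuantumFields.BalabanUV.Beta.EriceRemainderEnclosureHistoryAutonomyComparisonAgeCompositionStaticChainPairStepLattice

/-!
# EriceRemainderEnclosureHistoryAutonomyComparisonAgeCompositionStaticChainAdjacentPairTemplate — (E79c) THE ADJACENT-PAIR TEMPLATE: the observer step (◆)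
# above an adjacent pair `(z+1, z)`, ANY `z ≥ 1`, from ONE existential package of rational constants and numeric facts about the pair — plus the closed-form
# envelope lemmas that turn a handful of square-root roundings into those facts

Cell `pub-balaban`, β-function sub-cell, BINDER row D4 «RemainderConst leaves for Bałaban's split» (`HOME/BINDER-OWNERS.md`; owner lineage `b2b-balaban-beta-an4`;
this file by co-owner #2 lineage `b2b-balaban-beta-d4-p2`, generation 70), β-FLOW TEAM duty (1), FREEZE (0) honoured (def-free; imports `…WindowBounds` (closed forms
`le_readWindow_ratio`, `readWindow_le_ratio`), (E78e) `…AdjacentEnvelopes` (`lam1_ge`, `lam2_ge`), (E79b) `…PairStepLattice` (`pair_step_lattice`); nothing restated).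

HONEST FRAMING (page 1, verbatim and binding).  *"Discharging BetaPertH makes Bałaban's UV stability UNCONDITIONAL — a real constructive-QFT result; it is
NOT the continuum limit and NOT the Clay problem."*  THIS FILE DISCHARGES NOTHING OF THE KIND.  Finite non-negative linear∕real algebra — hypotheses of a census,
not facts; the age profile of Bałaban's (1.22) limit functional is NOT PRINTED ([I] p. 298; GAPS G-t4-U2-1∕-2) and NOT asserted.  Row D4 class UNCHANGED
(critical-path width 0; instance 0∕1; D4 DISCHARGE NO DATE).  HONEST DEPENDENCY: continuum YM on T⁴ ⇐ BetaPertH ∧ nine spine estimates (0/9 proved); BetaPertH ⇐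
(D1) ∧ (D4) ∧ CAP+tail; G-an2-4 gates asym, D1 and NE2/3/4.

THE POINT (census sense (α); route (N′); README `HOME/b2b-balaban-beta-d4-p2/g70/e79/README.md`).  The binding family of the observer induction, the adjacent
pairs, is proved for `z ≥ 16` ((E78i)); the fifteen pairs `z ≤ 15` have LARGER true margins (11–22 %) but need pair-specific constants (the uniform envelopes of
(E78d) fail below `z ≈ 12`; the decisive losses are the crude observer-ratio ends `α ≤ 1`, `β ≤ √(1+2∕z)`, whose spread product `D` is ~9× the true one —
`g70/numerics/adjband.py`).  §2 **`adjacent_pair_step_lattice`** is the statement of (E78i) for ANY `z ≥ 1` with ONE extra hypothesis: an existential package of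
eleven rational constants and their facts (five read-window envelopes, the two observer-ratio ends `S_{z+2,z} ≤ au·S_{z+2,z+1}` and `(z+1)S_{z,z+2} ≤
bu·z·S_{z+1,z+2}` via (E78c) `charge_ratio_antitone`∕`read_ratio_antitone` inside (E79b), `bl²z ≤ z+1`, box roundings, and the nine polynomial facts of (E79a)
with `r = z∕(z+1)`, `l1 = 549∕400`, `l2 = 2071∕1250`, `κ = 31∕40`, `th = 491∕625`) — so each remaining pair is ONE ~60-line theorem `facts_z` (E79d–f) and the
family closes by `interval_cases` (E79g).  §1 gives the closed-form envelope lemmas with rational square-root roundings as hypotheses (`sigma_lo_of`, `sigma_hi_of`,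
`phi_lo_of`, `phi_hi_of`, `self_lo_of` for all `z`; `au_of`, `bu_of` — adequate for `z ≥ 5`; for `z ≤ 4` the instances bound the two short ratio sums termwise).
NUMERICS (`g70/numerics/final_adj.py`, `mixed.py`, `gen_adj.py`, exact rational arithmetic): with these constants ALL NINE polynomials have ALL COEFFICIENTS
POSITIVE for every `z = 1, …, 15` (smallest coefficient `0.09` at `z = 1`, `≥ 0.26` for `z ≥ 5`).  NOT CLAIMED: the instances; the assembly; anything printed.

WHAT IS PROVED ([folklore]; 0 `def`, 0 sorry).  §1 `sigma_lo_of`, `sigma_hi_of`, `phi_lo_of`, `phi_hi_of`, `self_lo_of`, `au_of`, `bu_of`.  §2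
**`adjacent_pair_step_lattice`**.
-/
noncomputable section
open Finset

namespace Summit.QuantumFields.BalabanUV.Beta.EriceRemainderEnclosureHistoryAutonomyComparisonAgeCompositionStaticChainAdjacentPairTemplate

open Summit.QuantumFields.BalabanUV.Beta.EriceRemainderEnclosureHistoryAutonomyComparisonAgeCompositionStaticChainWindowBounds
open Summit.QuantumFields.BalabanUV.Beta.EriceRemainderEnclosureHistoryAutonomyComparisonAgeCompositionStaticChainAdjacentEnvelopes
open Summit.QuantumFields.BalabanUV.Beta.EriceRemainderEnclosureHistoryAutonomyComparisonAgeCompositionStaticChainPairStepLattice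

/-! ## §1 Envelope facts of an adjacent pair from square-root roundings (closed forms of `…WindowBounds`) -/

/-- `σ` lower: `S_{z+1,z} ≥ 2(z+1)(√2 − √((z+2)∕(z+1)))` (`le_readWindow_ratio`), so `sl(z+1) ≤ S_{z+1,z}` whenever `sl ≤ 2(A − U)`, `A ≤ √2`,
`√((z+2)∕(z+1)) ≤ U`. [folklore] -/
theorem sigma_lo_of {z : ℕ} {A U sl : ℝ} (hA : A ≤ Real.sqrt 2) (hU : Real.sqrt (((z : ℝ) + 2) / ((z : ℝ) + 1)) ≤ U) (hsl : sl ≤ 2 * (A - U)) :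
    sl * ((z : ℝ) + 1) ≤ ∑ m ∈ range z, Real.sqrt (((z : ℝ) + 1) / (((z : ℝ) + 1) + m + 1)) := by
  have hk : (0 : ℝ) < (z : ℝ) + 1 := by positivity
  have h := le_readWindow_ratio hk z
  have e1 : (1 : ℝ) + ((z : ℝ) + 1) / ((z : ℝ) + 1) = 2 := by field_simp; ring
  have e2 : (1 : ℝ) + 1 / ((z : ℝ) + 1) = ((z : ℝ) + 2) / ((z : ℝ) + 1) := by field_simp; ring
  rw [e1, e2] at h
  nlinarith [hk, hA, hU, hsl]

/-- `σ` upper: `S_{z+1,z} ≤ 2(z+1)(√((2z+1)∕(z+1)) − 1)` (`readWindow_le_ratio`), so `S_{z+1,z} ≤ su(z+1)` whenever `√((2z+1)∕(z+1)) ≤ U`, `2(U−1) ≤ su`. [folklore] -/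
theorem sigma_hi_of {z : ℕ} {U su : ℝ} (hU : Real.sqrt ((2 * (z : ℝ) + 1) / ((z : ℝ) + 1)) ≤ U) (hsu : 2 * (U - 1) ≤ su) :
    ∑ m ∈ range z, Real.sqrt (((z : ℝ) + 1) / (((z : ℝ) + 1) + m + 1)) ≤ su * ((z : ℝ) + 1) := by
  have hk : (0 : ℝ) < (z : ℝ) + 1 := by positivity
  have h := readWindow_le_ratio hk z
  have e1 : (1 : ℝ) + (z : ℝ) / ((z : ℝ) + 1) = (2 * (z : ℝ) + 1) / ((z : ℝ) + 1) := by field_simp; ring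
  rw [e1] at h
  nlinarith [hk, hU, hsu]

/-- `φ` lower: `S_{z,z+1} ≥ 2z(√((2z+2)∕z) − √((z+1)∕z))`, so `fl·z ≤ S_{z,z+1}` whenever `L ≤ √((2z+2)∕z)`, `√((z+1)∕z) ≤ U`, `fl ≤ 2(L−U)`. [folklore] -/
theorem phi_lo_of {z : ℕ} (hz : 1 ≤ z) {L U fl : ℝ} (hL : L ≤ Real.sqrt ((2 * (z : ℝ) + 2) / (z : ℝ))) (hU : Real.sqrt (((z : ℝ) + 1) / (z : ℝ)) ≤ U)
    (hfl : fl ≤ 2 * (L - U)) :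
    fl * (z : ℝ) ≤ ∑ m ∈ range (z + 1), Real.sqrt ((z : ℝ) / ((z : ℝ) + m + 1)) := by
  have hz' : (1 : ℝ) ≤ z := by exact_mod_cast hz
  have hk : (0 : ℝ) < (z : ℝ) := by positivity
  have h := le_readWindow_ratio hk (z + 1)
  push_cast at h
  have e1 : (1 : ℝ) + ((z : ℝ) + 1 + 1) / (z : ℝ) = (2 * (z : ℝ) + 2) / (z : ℝ) := by field_simp; ring
  have e2 : (1 : ℝ) + 1 / (z : ℝ) = ((z : ℝ) + 1) / (z : ℝ) := by field_simp
  rw [e1, e2] at h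
  nlinarith [hk, hL, hU, hfl]

/-- `φ` upper: `S_{z,z+1} ≤ 2z(√((2z+1)∕z) − 1)`, so `S_{z,z+1} ≤ fu·z` whenever `√((2z+1)∕z) ≤ U`, `2(U−1) ≤ fu`. [folklore] -/
theorem phi_hi_of {z : ℕ} (hz : 1 ≤ z) {U fu : ℝ} (hU : Real.sqrt ((2 * (z : ℝ) + 1) / (z : ℝ)) ≤ U) (hfu : 2 * (U - 1) ≤ fu) :
    ∑ m ∈ range (z + 1), Real.sqrt ((z : ℝ) / ((z : ℝ) + m + 1)) ≤ fu * (z : ℝ) := by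
  have hz' : (1 : ℝ) ≤ z := by exact_mod_cast hz
  have hk : (0 : ℝ) < (z : ℝ) := by positivity
  have h := readWindow_le_ratio hk (z + 1)
  push_cast at h
  have e1 : (1 : ℝ) + ((z : ℝ) + 1) / (z : ℝ) = (2 * (z : ℝ) + 1) / (z : ℝ) := by field_simp; ring
  rw [e1] at h
  nlinarith [hk, hU, hfu]

/-- `s` lower: `S_{z+1,z+1} ≥ 2(z+1)(√((2z+3)∕(z+1)) − √((z+2)∕(z+1)))`, so `slo(z+1) ≤ S_{z+1,z+1}` whenever `L ≤ √((2z+3)∕(z+1))`, `√((z+2)∕(z+1)) ≤ U`,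
`slo ≤ 2(L−U)`. [folklore] -/
theorem self_lo_of {z : ℕ} {L U slo : ℝ} (hL : L ≤ Real.sqrt ((2 * (z : ℝ) + 3) / ((z : ℝ) + 1))) (hU : Real.sqrt (((z : ℝ) + 2) / ((z : ℝ) + 1)) ≤ U)
    (hslo : slo ≤ 2 * (L - U)) :
    slo * ((z : ℝ) + 1) ≤ ∑ m ∈ range (z + 1), Real.sqrt (((z : ℝ) + 1) / (((z : ℝ) + 1) + m + 1)) := by
  have hk : (0 : ℝ) < (z : ℝ) + 1 := by positivity
  have h := le_readWindow_ratio hk (z + 1)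
  push_cast at h
  have e1 : (1 : ℝ) + ((z : ℝ) + 1 + 1) / ((z : ℝ) + 1) = (2 * (z : ℝ) + 3) / ((z : ℝ) + 1) := by field_simp; ring
  have e2 : (1 : ℝ) + 1 / ((z : ℝ) + 1) = ((z : ℝ) + 2) / ((z : ℝ) + 1) := by field_simp; ring
  rw [e1, e2] at h
  nlinarith [hk, hL, hU, hslo]

/-- Charge-ratio end `α₊`: `S_{z+2,z} ≤ 2(z+2)(√((2z+2)∕(z+2)) − 1)` and `S_{z+2,z+1} ≥ 2(z+2)(√2 − √((z+3)∕(z+2)))`, so `S_{z+2,z} ≤ au·S_{z+2,z+1}` whenever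
`√((2z+2)∕(z+2)) ≤ U`, `A ≤ √2`, `√((z+3)∕(z+2)) ≤ V < A`, `0 ≤ au` and `U − 1 ≤ au(A − V)`. [folklore] -/
theorem au_of {z : ℕ} {A U V au : ℝ} (hU : Real.sqrt ((2 * (z : ℝ) + 2) / ((z : ℝ) + 2)) ≤ U) (hA : A ≤ Real.sqrt 2)
    (hV : Real.sqrt (((z : ℝ) + 3) / ((z : ℝ) + 2)) ≤ V) (hau0 : 0 ≤ au) (hau : U - 1 ≤ au * (A - V)) :
    ∑ m ∈ range z, Real.sqrt ((((z : ℝ) + 1) + 1) / ((((z : ℝ) + 1) + 1) + m + 1))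
      ≤ au * ∑ m ∈ range (z + 1), Real.sqrt ((((z : ℝ) + 1) + 1) / ((((z : ℝ) + 1) + 1) + m + 1)) := by
  have hk : (0 : ℝ) < ((z : ℝ) + 1) + 1 := by positivity
  have h1 := readWindow_le_ratio hk z
  have h2 := le_readWindow_ratio hk (z + 1)
  push_cast at h2
  have e1 : (1 : ℝ) + (z : ℝ) / (((z : ℝ) + 1) + 1) = (2 * (z : ℝ) + 2) / ((z : ℝ) + 2) := by field_simp; ring
  have e2 : (1 : ℝ) + ((z : ℝ) + 1 + 1) / (((z : ℝ) + 1) + 1) = 2 := by field_simp; ring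
  have e3 : (1 : ℝ) + 1 / (((z : ℝ) + 1) + 1) = ((z : ℝ) + 3) / ((z : ℝ) + 2) := by field_simp; ring
  rw [e1] at h1
  rw [e2, e3] at h2
  -- `S_{z+2,z} ≤ 2(z+2)(U−1) ≤ 2(z+2)·au(A−V) ≤ au·S_{z+2,z+1}`
  have h3 : 2 * (((z : ℝ) + 1) + 1) * (U - 1) ≤ 2 * (((z : ℝ) + 1) + 1) * (au * (A - V)) := mul_le_mul_of_nonneg_left hau (by positivity)
  have h4 : au * (2 * (((z : ℝ) + 1) + 1) * (A - V)) ≤ au * ∑ m ∈ range (z + 1), Real.sqrt ((((z : ℝ) + 1) + 1) / ((((z : ℝ) + 1) + 1) + m + 1)) :=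
    mul_le_mul_of_nonneg_left (by nlinarith [h2, hA, hV, hk]) hau0
  nlinarith [h1, h3, h4, hU, hk]

/-- Read-ratio end `β₊`: `S_{z,z+2} ≤ 2z(√((2z+2)∕z) − 1)` and `S_{z+1,z+2} ≥ 2(z+1)(√((2z+4)∕(z+1)) − √((z+2)∕(z+1)))`, so `(z+1)S_{z,z+2} ≤ bu·(z·S_{z+1,z+2})`
whenever `√((2z+2)∕z) ≤ U`, `L ≤ √((2z+4)∕(z+1))`, `√((z+2)∕(z+1)) ≤ V < L`, `0 ≤ bu` and `U − 1 ≤ bu(L − V)`. [folklore] -/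
theorem bu_of {z : ℕ} (hz : 1 ≤ z) {U L V bu : ℝ} (hU : Real.sqrt ((2 * (z : ℝ) + 2) / (z : ℝ)) ≤ U) (hL : L ≤ Real.sqrt ((2 * (z : ℝ) + 4) / ((z : ℝ) + 1)))
    (hV : Real.sqrt (((z : ℝ) + 2) / ((z : ℝ) + 1)) ≤ V) (hbu0 : 0 ≤ bu) (hbu : U - 1 ≤ bu * (L - V)) :
    ((z : ℝ) + 1) * ∑ m ∈ range (z + 1 + 1), Real.sqrt ((z : ℝ) / ((z : ℝ) + m + 1))
      ≤ bu * ((z : ℝ) * ∑ m ∈ range (z + 1 + 1), Real.sqrt (((z : ℝ) + 1) / (((z : ℝ) + 1) + m + 1))) := by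
  have hz' : (1 : ℝ) ≤ z := by exact_mod_cast hz
  have hk : (0 : ℝ) < (z : ℝ) := by positivity
  have hk1 : (0 : ℝ) < (z : ℝ) + 1 := by positivity
  have h1 := readWindow_le_ratio hk (z + 1 + 1)
  have h2 := le_readWindow_ratio hk1 (z + 1 + 1)
  push_cast at h1 h2
  have e1 : (1 : ℝ) + ((z : ℝ) + 1 + 1) / (z : ℝ) = (2 * (z : ℝ) + 2) / (z : ℝ) := by field_simp; ring
  have e2 : (1 : ℝ) + ((z : ℝ) + 1 + 1 + 1) / ((z : ℝ) + 1) = (2 * (z : ℝ) + 4) / ((z : ℝ) + 1) := by field_simp; ring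
  have e3 : (1 : ℝ) + 1 / ((z : ℝ) + 1) = ((z : ℝ) + 2) / ((z : ℝ) + 1) := by field_simp; ring
  rw [e1] at h1
  rw [e2, e3] at h2
  -- `(z+1)S_{z,z+2} ≤ (z+1)·2z(U−1) ≤ (z+1)·2z·bu(L−V) ≤ bu·z·S_{z+1,z+2}`
  have h3 : ((z : ℝ) + 1) * ∑ m ∈ range (z + 1 + 1), Real.sqrt ((z : ℝ) / ((z : ℝ) + m + 1)) ≤ ((z : ℝ) + 1) * (2 * (z : ℝ) * (U - 1)) :=
    mul_le_mul_of_nonneg_left (by nlinarith [h1, hU, hk]) hk1.le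
  have h4 : ((z : ℝ) + 1) * (2 * (z : ℝ) * (U - 1)) ≤ ((z : ℝ) + 1) * (2 * (z : ℝ) * (bu * (L - V))) :=
    mul_le_mul_of_nonneg_left (mul_le_mul_of_nonneg_left hbu (by positivity)) hk1.le
  have h5 : bu * ((z : ℝ) * (2 * ((z : ℝ) + 1) * (L - V))) ≤ bu * ((z : ℝ) * ∑ m ∈ range (z + 1 + 1), Real.sqrt (((z : ℝ) + 1) / (((z : ℝ) + 1) + m + 1))) :=
    mul_le_mul_of_nonneg_left (mul_le_mul_of_nonneg_left (by nlinarith [h2, hL, hV, hk1]) hk.le) hbu0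
  have e4 : ((z : ℝ) + 1) * (2 * (z : ℝ) * (bu * (L - V))) = bu * ((z : ℝ) * (2 * ((z : ℝ) + 1) * (L - V))) := by ring
  linarith [h3, h4, h5, e4]

/-! ## §2 The template: the observer step above `(z+1, z)` from one package of constants and facts -/

/-- **THE ADJACENT-PAIR TEMPLATE.**  For ANY `z ≥ 1` and any level-coupled configuration above the adjacent pair `(z+1, z)` (letters exactly as in (E78i)
`adjacent_step_lattice`: older ages `k_l ≥ z+2`, loads, exact levels `a`, exact responses `cy`, `cz`, amplifications, window mass, `σ = S_{z+1,z}∕(z+1)`,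
`φ = S_{z,z+1}∕z`, `s = S_{z+1,z+1}∕(z+1)`, a defect `θ ≤ 0.7856`, the new load below its cap), the observer step (◆) with `κ = 31∕40` FOLLOWS FROM ONE
EXISTENTIAL PACKAGE `hfacts` of eleven rational constants `sl, su, fl, fu, slo, au, bl, bu, cl, ch, D` with: the five read-window envelopes of the pair, the two
observer-ratio ends (`S_{z+2,z} ≤ au·S_{z+2,z+1}`, `(z+1)S_{z,z+2} ≤ bu·z·S_{z+1,z+2}`), `bl² z ≤ z+1`, the box roundings, and the NINE POLYNOMIAL FACTS of (E79a)
(`r = z∕(z+1)`, `l1 = 549∕400`, `l2 = 2071∕1250` from (E78e) `lam1_ge`∕`lam2_ge`, `th = 491∕625`).  Each `z ≤ 15` is then one package (E79d…): §1 turns eight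
square-root roundings into the envelopes (`z ≥ 5`), the ratio ends are termwise for `z ≤ 4`; the polynomial facts have all coefficients positive for every
`z = 1, …, 15` (`g70/numerics/final_adj.py`, `mixed.py`).  Proof: (E79b) `pair_step_lattice` at `y = z+1`. [folklore] -/
theorem adjacent_pair_step_lattice {n z : ℕ} {k : ℕ → ℕ} {x a cy cz Sy Sz Ry Rz : ℕ → ℝ} {θ xy Ψyy Ψyz Ψzy Ψzz Ωz σ φ s : ℝ}
    (hz : 1 ≤ z)
    (hfacts : ∃ sl su fl fu slo au bl bu cl ch D : ℝ,
      0 ≤ sl ∧ sl * ((z : ℝ) + 1) ≤ ∑ m ∈ range z, Real.sqrt (((z : ℝ) + 1) / (((z : ℝ) + 1) + m + 1)) ∧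
      ∑ m ∈ range z, Real.sqrt (((z : ℝ) + 1) / (((z : ℝ) + 1) + m + 1)) ≤ su * ((z : ℝ) + 1) ∧
      0 ≤ fl ∧ fl * (z : ℝ) ≤ ∑ m ∈ range (z + 1), Real.sqrt ((z : ℝ) / ((z : ℝ) + m + 1)) ∧
      ∑ m ∈ range (z + 1), Real.sqrt ((z : ℝ) / ((z : ℝ) + m + 1)) ≤ fu * (z : ℝ) ∧
      1 / 2 ≤ slo ∧ slo * ((z : ℝ) + 1) ≤ ∑ m ∈ range (z + 1), Real.sqrt (((z : ℝ) + 1) / (((z : ℝ) + 1) + m + 1)) ∧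
      ∑ m ∈ range z, Real.sqrt ((((z : ℝ) + 1) + 1) / ((((z : ℝ) + 1) + 1) + m + 1))
        ≤ au * ∑ m ∈ range (z + 1), Real.sqrt ((((z : ℝ) + 1) + 1) / ((((z : ℝ) + 1) + 1) + m + 1)) ∧
      0 ≤ bl ∧ bl ^ 2 * (z : ℝ) ≤ (z : ℝ) + 1 ∧
      ((z : ℝ) + 1) * ∑ m ∈ range (z + 1 + 1), Real.sqrt ((z : ℝ) / ((z : ℝ) + m + 1))
        ≤ bu * ((z : ℝ) * ∑ m ∈ range (z + 1 + 1), Real.sqrt (((z : ℝ) + 1) / (((z : ℝ) + 1) + m + 1))) ∧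
      0 ≤ cl ∧ cl ≤ (z : ℝ) / ((z : ℝ) + 1) * bl ∧ au * bu ≤ ch ∧ (au - (z : ℝ) / ((z : ℝ) + 1)) * (bu - bl) ≤ D ∧
      (∀ Ψ : ℝ, 0 ≤ Ψ → 0 ≤ 4 * (31/40:ℝ) * ((549/400:ℝ) + ((2071/1250:ℝ) - (z : ℝ) / ((z : ℝ) + 1)) * Ψ)
          * (sl * fl + sl * bl * Ψ + fl * ((z : ℝ) / ((z : ℝ) + 1)) * Ψ + Ψ * (cl * Ψ) - D * Ψ ^ 2)
        - (1 + 2 * (31/40:ℝ) * Ψ) * ((1 + 2 * (31/40:ℝ) * (cl * Ψ)) * ((549/400:ℝ) + ((2071/1250:ℝ) - (z : ℝ) / ((z : ℝ) + 1)) * Ψ) - (1 - (491/625:ℝ)) * ((549/400:ℝ) + (2071/1250:ℝ) * Ψ))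
        - (1 + 2 * (31/40:ℝ) * (cl * Ψ)) * ((z : ℝ) / ((z : ℝ) + 1)) * ((549/400:ℝ) + (2071/1250:ℝ) * Ψ)) ∧
      (∀ Ψ : ℝ, 0 ≤ Ψ → 0 ≤ 4 * (31/40:ℝ) * ((549/400:ℝ) + ((2071/1250:ℝ) - (z : ℝ) / ((z : ℝ) + 1)) * Ψ)
          * (sl * fl + sl * bl * Ψ + fl * ((z : ℝ) / ((z : ℝ) + 1)) * Ψ + Ψ * (ch * Ψ) - D * Ψ ^ 2)
        - (1 + 2 * (31/40:ℝ) * Ψ) * ((1 + 2 * (31/40:ℝ) * (ch * Ψ)) * ((549/400:ℝ) + ((2071/1250:ℝ) - (z : ℝ) / ((z : ℝ) + 1)) * Ψ) - (1 - (491/625:ℝ)) * ((549/400:ℝ) + (2071/1250:ℝ) * Ψ))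
        - (1 + 2 * (31/40:ℝ) * (ch * Ψ)) * ((z : ℝ) / ((z : ℝ) + 1)) * ((549/400:ℝ) + (2071/1250:ℝ) * Ψ)) ∧
      (∀ Ψ : ℝ, 0 ≤ Ψ → 0 ≤ 4 * (31/40:ℝ) * (sl * fl + sl * bl * Ψ + fl * ((z : ℝ) / ((z : ℝ) + 1)) * Ψ + Ψ * (cl * Ψ) - D * Ψ ^ 2)
        - (1 + 2 * (31/40:ℝ) * Ψ) * ((1 + 2 * (31/40:ℝ) * (cl * Ψ)) - (1 - (491/625:ℝ))) - (1 + 2 * (31/40:ℝ) * (cl * Ψ)) * ((z : ℝ) / ((z : ℝ) + 1))) ∧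
      (∀ Ψ : ℝ, 0 ≤ Ψ → 0 ≤ 4 * (31/40:ℝ) * (sl * fl + sl * bl * Ψ + fl * ((z : ℝ) / ((z : ℝ) + 1)) * Ψ + Ψ * (ch * Ψ) - D * Ψ ^ 2)
        - (1 + 2 * (31/40:ℝ) * Ψ) * ((1 + 2 * (31/40:ℝ) * (ch * Ψ)) - (1 - (491/625:ℝ))) - (1 + 2 * (31/40:ℝ) * (ch * Ψ)) * ((z : ℝ) / ((z : ℝ) + 1))) ∧
      (∀ Ψ : ℝ, 0 ≤ Ψ → 0 ≤ (1 + 2 * (31/40:ℝ) * (cl * Ψ)) * (1 + 2 * (31/40:ℝ) * Ψ) * ((z : ℝ) / ((z : ℝ) + 1)) * ((549/400:ℝ) + (2071/1250:ℝ) * Ψ)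
        - 4 * (31/40:ℝ) * (su * fu + su * bu * Ψ + fu * au * Ψ + Ψ * (cl * Ψ) + D * Ψ ^ 2)
          * ((1 + 2 * (31/40:ℝ) * Ψ - 2 * slo - 2 * Ψ) * ((549/400:ℝ) + ((2071/1250:ℝ) - (z : ℝ) / ((z : ℝ) + 1)) * Ψ) + ((z : ℝ) / ((z : ℝ) + 1)) * ((549/400:ℝ) + (2071/1250:ℝ) * Ψ))) ∧
      (∀ Ψ : ℝ, 0 ≤ Ψ → 0 ≤ (1 + 2 * (31/40:ℝ) * (ch * Ψ)) * (1 + 2 * (31/40:ℝ) * Ψ) * ((z : ℝ) / ((z : ℝ) + 1)) * ((549/400:ℝ) + (2071/1250:ℝ) * Ψ)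
        - 4 * (31/40:ℝ) * (su * fu + su * bu * Ψ + fu * au * Ψ + Ψ * (ch * Ψ) + D * Ψ ^ 2)
          * ((1 + 2 * (31/40:ℝ) * Ψ - 2 * slo - 2 * Ψ) * ((549/400:ℝ) + ((2071/1250:ℝ) - (z : ℝ) / ((z : ℝ) + 1)) * Ψ) + ((z : ℝ) / ((z : ℝ) + 1)) * ((549/400:ℝ) + (2071/1250:ℝ) * Ψ))) ∧
      (∀ Ψ : ℝ, 0 ≤ Ψ → ((z : ℝ) / ((z : ℝ) + 1)) * ((549/400:ℝ) + (2071/1250:ℝ) * Ψ) ≤ 2 * (slo + Ψ) * ((549/400:ℝ) + ((2071/1250:ℝ) - (z : ℝ) / ((z : ℝ) + 1)) * Ψ)))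
    (hn : 0 < n) (hk : ∀ l, l < n → z + 2 ≤ k l) (hx : ∀ l, l < n → 0 ≤ x l)
    (hSy : ∀ l, l < n → Sy l = ∑ m ∈ range (z + 1), Real.sqrt ((k l : ℝ) / ((k l : ℝ) + m + 1)))
    (hSz : ∀ l, l < n → Sz l = ∑ m ∈ range z, Real.sqrt ((k l : ℝ) / ((k l : ℝ) + m + 1)))
    (hRy : ∀ l, l < n → Ry l = ∑ m ∈ range (k l), Real.sqrt (((z:ℝ) + 1) / (((z:ℝ) + 1) + m + 1)))
    (hRz : ∀ l, l < n → Rz l = ∑ m ∈ range (k l), Real.sqrt ((z : ℝ) / ((z : ℝ) + m + 1)))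
    (ha0 : ∀ i, i < n → 0 < a i)
    (ha : ∀ i, i < n → a i = 1 + ∑ l ∈ range n,
      (2 * x l * (∑ m ∈ range (k i), Real.sqrt ((k l : ℝ) / ((k l : ℝ) + m + 1))) / k l) * a l)
    (hcy : ∀ i, i < n → cy i = Ry i / ((z:ℝ) + 1) + ∑ l ∈ range n,
      (2 * x l * (∑ m ∈ range (k i), Real.sqrt ((k l : ℝ) / ((k l : ℝ) + m + 1))) / k l) * cy l)
    (hcz : ∀ i, i < n → cz i = Rz i / (z:ℝ) + ∑ l ∈ range n,
      (2 * x l * (∑ m ∈ range (k i), Real.sqrt ((k l : ℝ) / ((k l : ℝ) + m + 1))) / k l) * cz l)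
    (hΨyy : Ψyy = ∑ l ∈ range n, (2 * x l * Sy l / k l) * cy l) (hΨyz : Ψyz = ∑ l ∈ range n, (2 * x l * Sz l / k l) * cy l)
    (hΨzy : Ψzy = ∑ l ∈ range n, (2 * x l * Sy l / k l) * cz l) (hΨzz : Ψzz = ∑ l ∈ range n, (2 * x l * Sz l / k l) * cz l)
    (hΩz : Ωz = ∑ l ∈ range n, x l * (z:ℝ) / k l)
    (hσ : σ = (∑ m ∈ range z, Real.sqrt (((z:ℝ) + 1) / (((z:ℝ) + 1) + m + 1))) / ((z:ℝ) + 1))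
    (hφ : φ = (∑ m ∈ range (z + 1), Real.sqrt ((z : ℝ) / ((z : ℝ) + m + 1))) / (z:ℝ))
    (hs : s = (∑ m ∈ range (z + 1), Real.sqrt (((z:ℝ) + 1) / (((z:ℝ) + 1) + m + 1))) / ((z:ℝ) + 1))
    (hθ : θ ≤ 491/625) (hxy : 0 ≤ xy) (hcap : 2 * xy * (s + Ψyy) < 1) :
    (1 + 2 * (31/40:ℝ) * Ψzz) * (1 - Ωz) - (1 - θ) * (xy * (1 + 2 * (31/40:ℝ) * Ψyy))
      ≤ (1 - xy * (1 + 2 * (31/40:ℝ) * Ψyy)) *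
        ((1 + 2 * (31/40:ℝ) * Ψzz + 4 * (31/40:ℝ) * xy * ((σ + Ψyz) * (φ + Ψzy)) / (1 - 2 * (s + Ψyy) * xy)) * ((1 - Ωz) - xy / (((z:ℝ) + 1) / (z:ℝ)))) := by
  obtain ⟨sl, su, fl, fu, slo, au, bl, bu, cl, ch, D, hsl0, hsl, hsu, hfl0, hfl, hfu, hslo, hslo', hau, hbl0, hbl, hbu, hcl0, hcl, hch, hD,
    hFs_lo, hFs_hi, hF1_lo, hF1_hi, hG_lo, hG_hi, hpole⟩ := hfacts
  have hz' : (1 : ℝ) ≤ z := by exact_mod_cast hz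
  have hl1 := lam1_ge (y := z + 1) (by omega)
  have hl2 := lam2_ge (y := z + 1) (by omega)
  push_cast at hl1 hl2
  have hr2 : (z : ℝ) / ((z : ℝ) + 1) ≤ 2071 / 1250 := by
    rw [div_le_iff₀ (by positivity)]; nlinarith
  have h := pair_step_lattice (y := z + 1) (z := z) (κ := 31/40) (r := (z : ℝ) / ((z : ℝ) + 1)) (th := 491/625) (l1 := 549/400) (l2 := 2071/1250)
    (sl := sl) (su := su) (fl := fl) (fu := fu) (slo := slo) (au := au) (bl := bl) (bu := bu) (cl := cl) (ch := ch) (D := D)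
    (k := k) (x := x) (a := a) (cy := cy) (cz := cz) (Sy := Sy) (Sz := Sz) (Ry := Ry) (Rz := Rz)
    (θ := θ) (xy := xy) (Ψyy := Ψyy) (Ψyz := Ψyz) (Ψzy := Ψzy) (Ψzz := Ψzz) (Ωz := Ωz) (σ := σ) (φ := φ) (s := s)
    (by norm_num) (by norm_num) hn hz le_rfl hk hx hSy hSz
    (fun l hl => by push_cast; exact hRy l hl) hRz ha0 ha
    (fun i hi => by push_cast; exact hcy i hi) hcz hΨyy hΨyz hΨzy hΨzz hΩz
    (by push_cast; exact hσ) hφ (by push_cast; exact hs) (by push_cast; ring) hθ hxy hcap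
    hsl0 (by push_cast; exact hsl) (by push_cast; exact hsu) hfl0 hfl hfu hslo (by push_cast; exact hslo')
    (by push_cast; exact hau) hbl0 (by push_cast; exact hbl) (by push_cast; exact hbu) hcl0 hcl hch hD
    (by norm_num) (by push_cast; exact hl1) hr2 (by push_cast; exact hl2)
    hFs_lo hFs_hi hF1_lo hF1_hi hG_lo hG_hi hpole
  push_cast at h
  exact h

end Summit.QuantumFields.BalabanUV.Beta.EriceRemainderEnclosureHistoryAutonomyComparisonAgeCompositionStaticChainAdjacentPairTemplate

end
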